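import Mathlib

/-!
# Young-shadow SLACK on four pair splits — definitions of the explicit slack tensors
# (crux `RankRigidMinimalRepr`, stmt-ValiantsHypothesis-18034; frontier rung `LaplaceOptimalFive`, stmt-24813; line `shallow_collision`
#  rev 4, stub S2′ `stub_sideSym_offShell_five` = young-shadow K1; director-valiant g16 R286 (1)(ii): «type the three FAILING roles
#  K₁,₄ / C₄ / K₃ ⊔ K₂ as explicit slack-space statements»)

On three distinct pair splits of `Fin 5` the Young shadows of a side-symmetric decomposition SEPARATE (`…LaplaceFiveThreeSplit`,
`…ThreeSplitCrossSwap`), and likewise on the rigid four-split supports `P₅`, paw, chair.  On the three SLACK four-split supports —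
the star `K₁,₄ = {01,02,03,04}`, the four-cycle `C₄ = {01,12,23,30}` and the triangle-plus-edge `K₃ ⊔ K₂ = {01,02,12,34}` —
separation FAILS: there are side-symmetric tensors with fully symmetric sum that are not fully symmetric.  This file names the
explicit witnesses (all supported on the injective words, where the slack dimensions are `5`, `4`, `9 = 4 + 5`; summed over all
`126` letter contents the slack dimensions are `175`, `224`, `399` — exact census, `…FourSplitSlack.lean` docstring):

* `injC v` — the indicator of injective words; `pent a b` — the «pentagon minus pentagram» edge function on letters (`+1` on
  `{i, i+1}`, `−1` on `{i, i+2}` mod `5`; symmetric, every vertex sum `0`, i.e. a vector of `S^{(3,2)}`); `ind0 a = [a = 0]`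
  (a letter potential, `S^{(4,1)}` up to constants);
* `edgePent p q v = [v injective] · pent (v p) (v q)` and `edgePot p q v = [v injective] · (ind0 (v p) + ind0 (v q))` — tensors
  side-symmetric for the pair split `{p, q}` (`…FourSplitSlack.edge_sideSym`), the building blocks of the three slack spaces.

HONEST FRAMING: definitions only (negative-calibration objects for S2′); `LaplaceOptimalFive` (stmt-24813) stays OPEN · CONTESTED
72/120; nothing here bears on `VP ≠ VNP`, which is NOT proved.
-/

set_option autoImplicit false

-- the mandated summit-side namespace repeats a component by design (single-problem summit)
set_option linter.dupNamespace false

namespace Summit.ValiantsHypothesis.ValiantsHypothesis.Theorems.RigidityForcesSymmetryRankRigidMinimalRepr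

namespace LaplaceFiveSectorSplit

/-- Indicator of the injective words, as a complex number. -/
noncomputable def injC (v : Fin 5 → Fin 5) : ℂ := if Function.Injective v then 1 else 0

/-- «Pentagon minus pentagram» on the letters `Fin 5 = ℤ/5`: `+1` on the edges `{i, i+1}`, `−1` on the edges `{i, i+2}`, `0` on the
diagonal.  Symmetric; every vertex sum vanishes (a generator of the `S^{(3,2)}`-isotypic edge functions). -/
def pent (a b : Fin 5) : ℤ :=
  if b = a + 1 ∨ a = b + 1 then 1 else if b = a + 2 ∨ a = b + 2 then -1 else 0

/-- The letter potential `[a = 0]` (non-constant; potentials modulo constants are the `S^{(4,1)}`-isotypic edge functions). -/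
def ind0 (a : Fin 5) : ℤ := if a = 0 then 1 else 0

/-- Slack building block of type `(3,2)` on the pair split `{p, q}`: `[v injective] · pent (v p) (v q)`. -/
noncomputable def edgePent (p q : Fin 5) (v : Fin 5 → Fin 5) : ℂ := injC v * (pent (v p) (v q) : ℂ)

/-- Slack building block of type `(4,1)` on the pair split `{p, q}`: `[v injective] · ([v p = 0] + [v q = 0])`. -/
noncomputable def edgePot (p q : Fin 5) (v : Fin 5 → Fin 5) : ℂ := injC v * ((ind0 (v p) : ℂ) + (ind0 (v q) : ℂ))

end LaplaceFiveSectorSplit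

end Summit.ValiantsHypothesis.ValiantsHypothesis.Theorems.RigidityForcesSymmetryRankRigidMinimalRepr
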